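import Literature.AnabelianGeometry.SemiGraphs.MetabelianLeafStarCharacters
import Literature.AnabelianGeometry.SemiGraphs.MetabelianLeafStarQuasiCoherent
import Literature.AnabelianGeometry.SemiGraphs.TemperedTorsorCharacter
import Literature.AnabelianGeometry.SemiGraphs.TemperedLevelKernelCharOpenCore
import HarnessLib

/-!
# A level of the canonical tower of `𝒢⋆(p)` adapted to ALL the translation characters `ψ̄_n`
# («RAYLESS-STAR·CIV-NEG», brick S5d, part 2)

Mochizuki, *Semi-graphs of anabelioids*, Publ. RIMS **42** (2006), §3, Def. 3.5 (ii) p. 37, Prop. 3.6 p. 38;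
[IUTchI] Rmk. 2.5.3 (i) (T2) p. 52 ("Galois-countable": a countable cofinal family of finite étale Galois
coverings) [cite: MochizukiSemiAnbd2006, Prop 3.6 p.38].

PROOF-ONLY file (abc-iut cell, layer L3, row «RAYLESS-STAR·CIV-NEG», seat abc-iut-L3-t8 gen 6; desk memo
VERTICAL-ESCAPE-RAYLESS-STAR-L3t8g6.md §4).

* `exists_level_stabilizer_mem_leafStarVertexLevel`: for the rayless counter-carrier `𝒢⋆(p)` and every bound
  `M`, from some level on the point stabilisers of the tower levels lie in the quasi-coherence levels
  `leafStarVertexLevel p M` / `edgeLevel p M` (abc-iut-L3-t6's `exists_level_splits_of_isFinite` — every FINITE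
  covering is split by the canonical tower from some level on — applied to abc-iut-L3-t5's SPLITTER of these
  levels, `exists_splitter_of_compatibleLevels`);
* `exists_level_adaptedTo_leafStarPsi`: hence ONE level `i₁` adapted (`CovObj.AdaptedTo`) to the translation
  characters `ψ_{n,1} = ψ̄_n` (modulus `p`) for ALL `n` simultaneously — the level at which the finitely many
  leaf types crossed by a fixed element of `π₁^temp` are read off in the escape.

No definition, no named fact; no side taken on [IUTchIII] Cor 3.12.
-/

noncomputable section

open CategoryTheory Topology Multiplicative

namespace Literature.AnabelianGeometry.SemiGraphs

open IwahoriWitness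

namespace ProfiniteSemiGraph


/-! ### The quasi-coherence levels of `𝒢⋆(p)` as stabiliser bounds of the tower -/

variable (p : ℕ) [hp : Fact p.Prime]

/-- The quasi-coherence vertex levels are normal. [cite: MochizukiSemiAnbd2006, Def 2.3(iii) p.25] -/
theorem leafStarVertexLevel_normal (M : ℕ) (v : (metabelianLeafStar p).graph.Vertex) :
    (leafStarVertexLevel p M v).Normal := by
  cases v with
  | none => exact FreeProPRankTwo.centreLevel_normal p M
  | some n => exact Iw.leafLevel_normal _ n M

/-- The quasi-coherence vertex levels are open. [cite: MochizukiSemiAnbd2006, Def 2.3(iii) p.25] -/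
theorem isOpen_leafStarVertexLevel (M : ℕ) (v : (metabelianLeafStar p).graph.Vertex) :
    IsOpen (leafStarVertexLevel p M v : Set ((metabelianLeafStar p).Gv v)) := by
  cases v with
  | none => exact FreeProPRankTwo.isOpen_centreLevel p M
  | some n => exact Iw.isOpen_leafLevel _ (FreeProPRankTwo.isOpen_edgeLevel p M) n M

/-- The quasi-coherence vertex levels have uniformly bounded index. [cite: MochizukiSemiAnbd2006, Def 2.3(iii) p.25] -/
theorem leafStarVertexLevel_index (M : ℕ) :
    ∃ B : ℕ, ∀ v, (leafStarVertexLevel p M v).index ≠ 0 ∧ (leafStarVertexLevel p M v).index ≤ B := by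
  refine ⟨max (FreeProPRankTwo.centreLevel p M).index
    (Nat.card (IwMod p M × (Multiplicative ℤ_[p] ⧸ FreeProPRankTwo.edgeLevel p M))), ?_⟩
  rintro (_ | n)
  · exact ⟨FreeProPRankTwo.centreLevel_index_ne_zero p M, le_max_left _ _⟩
  · obtain ⟨h0, hle⟩ := Iw.leafLevel_index_le _ (FreeProPRankTwo.isOpen_edgeLevel p M) n M
    exact ⟨h0, hle.trans (le_max_right _ _)⟩

/-- The quasi-coherence levels are compatible with the gluings. [cite: MochizukiSemiAnbd2006, Def 2.3(iii) p.25] -/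
theorem comap_brHom_leafStarVertexLevel (M : ℕ) (b : (metabelianLeafStar p).graph.Branch)
    (v : (metabelianLeafStar p).graph.Vertex) (h : (metabelianLeafStar p).graph.abuts b = some v) :
    (leafStarVertexLevel p M v).comap ((metabelianLeafStar p).brHom b v h).toMonoidHom =
      FreeProPRankTwo.edgeLevel p M := by
  obtain ⟨n, c⟩ := b
  have hv : SemiGraph.leafStarVertexOf (n, c) = v := Option.some.inj h
  subst hv
  cases c
  · exact Iw.comap_lowHom_leafLevel _ (fun t ht => FreeProPRankTwo.dvd_of_mem_edgeLevel p ht) n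
  · exact FreeProPRankTwo.comap_θα_centreLevel p M n

/-- **From some level on, the point stabilisers of the canonical tower of `𝒢⋆(p)` lie in the quasi-coherence
levels of bound `M`** (the tower eventually splits the splitter of these levels).
[cite: MochizukiSemiAnbd2006, Prop 3.6 p.38] -/
theorem exists_level_stabilizer_mem_leafStarVertexLevel (h36 : (metabelianLeafStar p).Prop36Hypotheses) (M : ℕ) :
    ∃ i : ℕ, ∀ j, i ≤ j →
      (∀ (v : (metabelianLeafStar p).graph.Vertex)
        (x : ((((metabelianLeafStar p).galoisLevelData h36).S j).SV v).obj.V) (g : (metabelianLeafStar p).Gv v),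
        ((((metabelianLeafStar p).galoisLevelData h36).S j).SV v).obj.ρ g x = x → g ∈ leafStarVertexLevel p M v) ∧
      (∀ (e : (metabelianLeafStar p).graph.Edge)
        (x : ((((metabelianLeafStar p).galoisLevelData h36).S j).SE e).obj.V) (g : (metabelianLeafStar p).Ge e),
        ((((metabelianLeafStar p).galoisLevelData h36).S j).SE e).obj.ρ g x = x →
          g ∈ FreeProPRankTwo.edgeLevel p M) := by
  obtain ⟨S, hSfin, hSne, hSV, hSE⟩ := exists_splitter_of_compatibleLevels (𝒢 := metabelianLeafStar p)
    (leafStarVertexLevel p M) (fun _ => FreeProPRankTwo.edgeLevel p M) (leafStarVertexLevel_normal p M)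
    (fun _ => (inferInstance : (FreeProPRankTwo.edgeLevel p M).Normal)) (isOpen_leafStarVertexLevel p M)
    (fun _ => FreeProPRankTwo.isOpen_edgeLevel p M) (leafStarVertexLevel_index p M)
    (fun _ => FreeProPRankTwo.edgeLevel_index_ne_zero p M) (comap_brHom_leafStarVertexLevel p M)
  obtain ⟨i, hi⟩ := (metabelianLeafStar p).exists_level_splits_of_isFinite h36 S hSfin
  refine ⟨i, fun j hj => ⟨fun v x g hgx => ?_, fun e x g hgx => ?_⟩⟩
  · obtain ⟨s⟩ := hSne.1 v
    exact (hSV v s g).1 ((hi j hj).1 v x g hgx s)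
  · obtain ⟨s⟩ := hSne.2 e
    exact (hSE e s g).1 ((hi j hj).2 e x g hgx s)

/-! ### One level adapted to all the characters `ψ̄_n` -/

/-- The translation character `ψ_{n,1} = ψ̄_n` (modulus `p`) kills the quasi-coherence level of bound `1` at
every vertex. [cite: MochizukiSemiAnbd2006, Thm 3.7(iii) p.41] -/
theorem leafStarPsiV_eq_one_of_mem_leafStarVertexLevel (n : ℕ) (v : (metabelianLeafStar p).graph.Vertex)
    {g : (metabelianLeafStar p).Gv v} (hg : g ∈ leafStarVertexLevel p 1 v) :
    leafStarPsiV p n 1 (Nat.succ_le_succ (Nat.zero_le n)) v g = 1 := by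
  cases v with
  | none => rfl
  | some m =>
    have hg' : g ∈ Iw.leafLevel (FreeProPRankTwo.edgeLevel p 1) m 1 := hg
    exact leafStarPsiV_leaf_eq_one_of_norm_le p n 1 _ m g
      ((Iw.toMod_eq_one_iff (n := 1) _).1 ((Iw.mem_leafLevel_iff _ m 1 g).1 hg').1).1

/-- **One level of the canonical tower of `𝒢⋆(p)` is adapted to ALL the translation characters `ψ̄_n`**
(`n ∈ ℕ`), and so is every deeper level. [cite: MochizukiSemiAnbd2006, Prop 3.6 p.38] -/
theorem exists_level_adaptedTo_leafStarPsi (h36 : (metabelianLeafStar p).Prop36Hypotheses) :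
    ∃ i : ℕ, ∀ j, i ≤ j → ∀ n : ℕ,
      CovObj.AdaptedTo (leafStarPsiV p n 1 (Nat.succ_le_succ (Nat.zero_le n))) (leafStarPsiE p 1)
        (((metabelianLeafStar p).galoisLevelData h36).S j) := by
  obtain ⟨i, hi⟩ := exists_level_stabilizer_mem_leafStarVertexLevel p h36 1
  refine ⟨i, fun j hj n => ⟨fun v x g hgx => ?_, fun e x g _ => rfl⟩⟩
  exact leafStarPsiV_eq_one_of_mem_leafStarVertexLevel p n v ((hi j hj).1 v x g hgx)

end ProfiniteSemiGraph

end Literature.AnabelianGeometry.SemiGraphs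

end
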